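import Summits.QuantumFields.YangMills.Theorems.BalabanUVNodesClusters
import Literature.MathematicalPhysics.QuantumFieldTheory.Balaban1983to89.T4EtaRate
import Literature.MathematicalPhysics.QuantumFieldTheory.Balaban1983to89.T4OutputRate
import Summits.QuantumFields.BalabanUV.T4Continuum.Spine.NE1p.DressedRootStrict
import Summits.QuantumFields.BalabanUV.T4Continuum.Support.NE3EnergyWeightedCovShape
import Summits.QuantumFields.BalabanUV.T4Continuum.Spine.NE4.Targets

/-!
# BalabanUVNodes ∕ SpineRates (2∕3) — cluster K4 «SpineRates» BY NAME: the rate carriers `RateCarriers N` (one sub-bundle per producer, SHARED where the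
# tree's edges demand it), the rate-record predicate PARAMETER `RRec : RateRecordPred N`, the by-name node statements N14 · N15 · N16 · N17 · N18 · N22 ·
# (D4), the stubs `S_N14 … S_D4`, `S_R00x`, the instantiation `Inputs := RateInputs RRec` (∃) ∕ `RateInputsAll RRec` (∀), and the joins

SUPPLY TEXT (b2b-balaban-t4-dagwriter gen 76, v2 gen 83, 2026-08-25∕26) for the ONE WRITER of route «BalabanUVNodes» (pub-ymgap plan, director-ym LINE №8a,
D-0061) to file through a prover ∕ dag seat — `Summits/…/Theorems` is prover-only (D-0016); the dagwriter seat opens, edits and files NOTHING.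
WHY A `YangMills/Theorems` HOME: a route file may import only Mathlib ∕ Literature ∕ HarnessLib ∕ `Summits.<P>.Statement` ∕ `Summits.<P>.Theorems.*`
(gate, verbatim, 2026-08-25) — NOT the `Summits.QuantumFields.BalabanUV.*` subtree these statements are typed over; a Theorems module may import it
(precedent `Y2BridgeKing.lean` ⟵ `Summits.Ventures.…`), and the route then lists `imports: [Summits.QuantumFields.YangMills.Theorems.<this module>]`.
V2 (gen 83) = V1 04f3f9512bcf66e0 with ONE docstring sentence added to `U3Carriers` (the plan's design word of record [YMPLAN-G61-WORD-U3-DRESSED],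
pub-ymgap INBOX l.10200, 2026-08-26: the U3 carriers of record INCLUDE the dressed domains); every declaration is byte-identical to V1 — no signature change.
HONEST FRAMING.  Typing and bookkeeping only: hypothesis shapes named in `def`s, joins = compositions of tree theorems; 0 `sorry`, 0 `opaque`, standard
axioms.  NOTHING of Bałaban's is asserted, no node is discharged; [B12] Thm 2 unproved in print; NE7 ∕ NE7b ∕ NE7c not proved; ONE finite four-torus
programme — NOT infinite volume, NOT OS on ℝ⁴, NOT a mass gap, NOT Clay; `UVD59` is NOT the Y2 bridge's `UV G r a := MomentBounds6 G r a`
(`Y2BridgeKing.lean`): no tree arrow joins the two currencies (the spine route owner's seam item, LINE №5).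

K4 FACTS THE ROUTE WRITER NEEDS (dagwriter g75 word `K4-SPINERATES-dagwriter-g75.md` 5930193cb50449f5; lead ERRATUM to R420 (C), pub-ymgap INBOX l.8815):
(a) N17 (NE4 on the datum) has NO tree theorem from N15∕N16; the tree's only edge into `Spine.NE4.NE4OnData` is U3 → U2 (`Spine.NE4.Targets.u2Inputs_of_u3`)
from N18 (NE5 as a b-family) + N22 (NE9 ∧ FadingMemory) + (D4) read-out — typed both ways: (α) `S_N17` a stub, (β) `N17_of_U3edge` glue + `S_D4` stub;
(b) COHERENCE: both NE9 consumers need N18 ∕ N22 on the SAME `(C, W, κ, EA)` — hence ONE `U3Carriers` sub-bundle; (c) NE3's `(L, Nper)` are block factor and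
unit-lattice PERIOD, not the gauge rank.  Joins: `SpineRates_of` (α), `SpineRates_of_glueN17` (β), `SpineRates_of_forall` + `spineRates_exists_of_forall`
(∀-packaging), and the stub-level top joins `uvD59_of_K4K5stubs` ∕ `uvD59_of_K4K5stubs_glueN17` (every K1–K5 stub in the term).
Text of record: dagwriter g75 `UVSplit+K4.lean` 4830e9627e170956 §7 verbatim.
-/

namespace YMDAG.UVSplit

open Literature.MathematicalPhysics.QuantumFieldTheory.Balaban1983to89
open Literature.MathematicalPhysics.QuantumFieldTheory.Balaban1983to89.T4Continuum
open Summit.QuantumFields.BalabanUV.T4Continuum.Spine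

/-! ## §7 CLUSTER K4 «SpineRates» BY NAME (gen 75): rate carriers, the parameter `RRec`, stubs N14 · N15 · N16 · N17 · N18 · N22 · (D4) · R00x, joins -/

open Literature.MathematicalPhysics.QuantumFieldTheory.Balaban1983to89.B9 (KernelFamily SiteKernel)
open Literature.MathematicalPhysics.QuantumFieldTheory.Balaban1983to89.T4EtaRate (PairedInstance NE2PlusOperator NE2PlusSite NE2PlusUnit)
open Literature.MathematicalPhysics.QuantumFieldTheory.Balaban1983to89.T4OutputRate (Carriers Functional NE5 NE9 FadingMemory)
open Literature.MathematicalPhysics.QuantumFieldTheory.Balaban1983to89.T4BetaReadOut (Slice ReadOut RepresentsA RepresentsB)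
open Literature.MathematicalPhysics.QuantumFieldTheory.Balaban1983to89.T4BetaReadOutLipschitz (ReadBoundedOn ReadCovariantOn)
open Summit.QuantumFields.BalabanUV.T4Continuum
open Summit.QuantumFields.BalabanUV.T4Continuum.NE1p.DressedRoot (DressedTower DressedStabilityStrict DressedStability dressedStability_of_strict)
open Summit.QuantumFields.BalabanUV.T4Continuum.NE3EnergyWeightedCovShape (NE3EnergyRateWCov)
open Summit.QuantumFields.BalabanUV.T4Continuum.MinimalActionRate (sfClass)

/-! ### §7.1 The RATE CARRIERS — one sub-bundle per producer, SHARED where the tree's edges demand it -/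

/-- N14's carriers (venue `N14_NE1p.lean`): the dressed tower of the observable-attached run (`Spine/NE1p/DressedRoot.lean` :110) and the bookings'
positional rate `Λ`. -/
structure NE1pCarriers where
  P : Type
  𝒯 : DressedTower P
  Λ : ℝ

/-- N15's carriers (venue `N15_NE2.lean`): one family of paired instances with its [B9] kernel families, kernel exponent `p`, regularity letter `c35`. -/
structure NE2Carriers where
  I : Type
  c35 : ℝ
  p : ℝ
  pi : I → PairedInstance
  Kop : ∀ i, KernelFamily (pi i).gc (pi i).Bf
  Ksite : ∀ i, SiteKernel (pi i).gc (pi i).Bf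
  Kunit : ∀ i, SiteKernel (pi i).gc (pi i).Bf
  inΛ : ∀ i, (pi i).gc.Site → Prop
  unitDist : ∀ i, (pi i).gc.Site → (pi i).gc.Site → ℝ

/-- N16's carriers (venue `N16_NE3.lean`, colour index `Fin N` for SU(N)): block factor `L` (record: `= F.L`), scale-0 period `Nper` (venue letter `N`),
small-field radius `ε`, regularity letters `b g`, constants `C Λ₁ Λ₂'`, admissible unit-lattice data `dom`. -/
structure NE3Carriers (N : ℕ) where
  L : ℕ
  Nper : ℕ
  ε : ℝ
  b : ℝ
  g : ℝ
  C : ℝ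
  Λ₁ : ℝ
  Λ₂' : ℝ
  dom : Set (B7Prop1Explicit.Site 4 → Fin 4 → (Matrix (Fin N) (Fin N) ℂ)ˣ)

/-- NODE U3's carriers, SHARED by N18 (NE5), N22 (NE9 ∧ fading memory), the dependent N17 (NE4) and the (D4) read-out: output carriers `C`, coupling
window `W` with radius `γ`, decay `κ`, run A's functional `EA`, run B's first-coupling family `EB` (`T4BetaReadOut.RepresentsB`), NE5 letters `θ C₅`,
history moduli `Λ` with fading-memory letters `C₉ ω`, read-out domination constant `cr` and joint rate `ρ ≥ max θ ω` (`u2Inputs_of_u3`).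
DESIGN OF RECORD (plan [YMPLAN-G61-WORD-U3-DRESSED], pub-ymgap INBOX l.10200, 2026-08-26; `T4OutputRate.Carriers.Dom` is ABSTRACT, so nothing here
changes): the carriers OF RECORD INCLUDE the observable-attached (dressed) domains — the instancing `RRec` takes `C.Dom := Dom₀ ⊕ (Dom₀ × T)` (`T` = the
source letters on the compact window `|t| ≤ l₀`), `scale (X,t) := scale X`, `d (X,t) := d X`, `EA g U (X,t) := D_t(X; g, U)` the dressed piece (vacuum
indices as before), whence `N18At` ∕ `N22At` (`∀ X : C.Dom`) STATE the dressed two-run rates at the SAME letters with `C₅`, `Λ` (and `ω`) UNIFORM in `t`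
on the source window — a prover's burden inside N18 ∕ N22, no new node shape, no dressed twin — and N17 ∕ the (D4) read-out are unaffected (dressed
indices carry weight 0 in the instancer's `ReadOut`; `u2Inputs_of_u3` composes verbatim). -/
structure U3Carriers where
  C : Carriers
  W : Set (ℕ → ℝ)
  γ : ℝ
  κ : ℝ
  EA : Functional C C.BgA
  EB : ℝ → Functional C C.BgB
  θ : ℝ
  C₅ : ℝ
  Λ : ℕ → ℕ → ℝ
  C₉ : ℝ
  ω : ℝ
  cr : ℝ
  ρ : ℝ

/-- THE RATE-CARRIER BUNDLE of one loop string along one tuned run of the datum (what K4's stubs and N19's edge quantify over). -/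
structure RateCarriers (N : ℕ) where
  ne1 : NE1pCarriers
  ne2 : NE2Carriers
  ne3 : NE3Carriers N
  u3 : U3Carriers

/-- PARAMETER — «`R` are the rate carriers OF RECORD of Bałaban's run for the datum `D`, the tuned bare sequence `g₀`, the loop string `os`» (venue
`CarriersOfRecordN14∕15∕16∕17∕18∕22` as ONE coherent predicate; instantiated by NODE 00's later-stage record predicate, `--informal` until it lands per R422 (A) (P2)). -/
abbrev RateRecordPred (N : ℕ) [NeZero N] := ∀ F : T4Family, Datum F N → (ℕ → ℝ) → List (ULoop F) → RateCarriers N → Prop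

/-! ### §7.2 The node statements BY NAME on the carriers -/

/-- N14 · NE1′ on its carriers (venue `YMDAG.N14`). -/
def N14At (c : NE1pCarriers) : Prop := DressedStabilityStrict c.𝒯 c.Λ

/-- N15 · NE2 on its carriers: the three NE2⁺ layers (venue `YMDAG.N15`, d = 4). -/
def N15At (c : NE2Carriers) : Prop :=
  NE2PlusOperator c.c35 c.pi c.Kop ∧ NE2PlusSite 4 c.p c.c35 c.pi c.Ksite ∧ NE2PlusUnit c.c35 c.pi c.Kunit c.inΛ c.unitDist

/-- N16 · NE3 on its carriers (venue `YMDAG.N16` at `n := Fin N`). -/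
def N16At {N : ℕ} (c : NE3Carriers N) : Prop :=
  NE3EnergyRateWCov 4 (sfClass 4 c.L c.Nper c.ε) c.L c.Nper c.b c.g c.C c.Λ₁ c.Λ₂' c.dom

/-- N18 · NE5 on node U3's carriers, at every member of run B's first-coupling family (venue `YMDAG.N18` per member). -/
def N18At (u : U3Carriers) : Prop := ∀ b : ℝ, 0 < b → b ≤ u.γ → NE5 u.EA (u.EB b) u.W u.κ u.θ u.C₅

/-- N22 · NE9 ∧ fading memory on node U3's carriers, run A (venue `YMDAG.N22`). -/
def N22At (u : U3Carriers) : Prop := NE9 u.EA u.W u.κ u.Λ ∧ FadingMemory u.C₉ u.ω u.Λ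

section OnDatum

variable {F : T4Family} {N : ℕ} [NeZero N]

/-- N17 · NE4 ON THE DATUM at the dependent letters `(cr·C₅·θ, ρ, γ)` (venue `YMDAG.N17`; `= T4CouplingMatching.ScaleShiftRate … D.βfun`). -/
def N17At (D : Datum F N) (u : U3Carriers) : Prop := NE4.NE4OnData D (u.cr * u.C₅ * u.θ) u.ρ u.γ

/-- (D4) THE β-READ-OUT BINDERS ON THE DATUM — exactly the hypotheses of `Spine.NE4.Targets.u2Inputs_of_u3` other than NE5, NE9, fading memory:
the window contains the boxes, the data's β-functions ARE the read-out of the two runs' functionals (`RepresentsA∕B`), the functionals lie in slice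
classes on which the recipe is `cr`-bounded and transport-covariant, and the letter signs `0 ≤ cr, C₅, θ, ω`, `θ, ω ≤ ρ`.  NOT IN PRINT beyond the
linearity of [Balaban1987RG1] (1.20)–(1.22) p. 264 (the decls' docstrings). -/
def ReadOutAt (D : Datum F N) (u : U3Carriers) : Prop :=
  ∃ (𝒜A : Set (Slice u.C u.C.BgA)) (𝒜B : Set (Slice u.C u.C.BgB)) (rA : ReadOut u.C u.C.BgA) (rB : ReadOut u.C u.C.BgB),
    (∀ k (v : Fin (k + 1) → ℝ), v ∈ FlowStep.Box u.γ k → T4FlagMemory.extd v ∈ u.W) ∧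
    RepresentsA u.EA rA u.γ D.βfun ∧ RepresentsB u.EB rB u.γ D.βfun ∧
    (∀ g ∈ u.W, u.EA g ∈ 𝒜A) ∧ (∀ b, 0 < b → b ≤ u.γ → ∀ g ∈ u.W, u.EB b g ∈ 𝒜B) ∧
    ReadBoundedOn 𝒜A rA u.κ u.cr ∧ ReadCovariantOn 𝒜A 𝒜B rA rB u.κ u.cr ∧
    0 ≤ u.cr ∧ 0 ≤ u.C₅ ∧ 0 ≤ u.θ ∧ 0 ≤ u.ω ∧ u.θ ≤ u.ρ ∧ u.ω ≤ u.ρ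

/-- **THE U3 → U2 EDGE AT THE CARRIERS (kernel)**: (D4) ∧ N18 ∧ N22 ⇒ N17, by `Spine.NE4.Targets.u2Inputs_of_u3` BY NAME. -/
theorem n17At_of_u3 (D : Datum F N) {u : U3Carriers} (hD4 : ReadOutAt D u) (h18 : N18At u) (h22 : N22At u) : N17At D u := by
  obtain ⟨𝒜A, 𝒜B, rA, rB, hW, hA, hB, h𝒜A, h𝒜B, hr, hcov, hcr, hC₅, hθ, hω, hθρ, hωρ⟩ := hD4
  exact (NE4.u2Inputs_of_u3 D hW h18 h22.1 h22.2 hA hB h𝒜A h𝒜B hr hcov hcr hC₅ hθ hω hθρ hωρ).ne4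

/-- **K4's CONCLUSION FOR ONE STRING at given carriers**: the six in-edges of N19 (NE1′, NE2, NE3, NE4, NE5, NE9) — what `S_N19`'s `Inputs` binder unpacks. -/
def RatesAt (D : Datum F N) (R : RateCarriers N) : Prop :=
  N14At R.ne1 ∧ N15At R.ne2 ∧ N16At R.ne3 ∧ N17At D R.u3 ∧ N18At R.u3 ∧ N22At R.u3

/-- Bookkeeping (kernel): the weak dressed-stability headline (venue `N14weak`) at any carriers carrying the rates. -/
theorem dressedStability_of_ratesAt {D : Datum F N} {R : RateCarriers N} (h : RatesAt D R) : DressedStability R.ne1.𝒯 :=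
  dressedStability_of_strict h.1

end OnDatum

/-! ### §7.3 The K4 STUB SIGNATURES as named `Prop`s over the parameters (a skeleton quotes them: `theorem stub_N15 : S_N15 <RRec> := by sorry`) -/

section SplitK4

variable {N : ℕ} [NeZero N] (Rec : RecordPred N) (SRec : SpineRecordPred N) (RRec : RateRecordPred N)

/-- R00x · THE RATE CARRIERS OF RECORD EXIST UNDER THE PINS — for all small-coupling tuned runs of the datum of record and every loop string
(the ∃-half; in-edges NODE 00 later stages, N11–N13 for the dressed tower, N02∕N03∕N06 for the paired instances). -/
def S_R00x : Prop := ∀ (F : T4Family) (D : Datum F N) (w : DagBinding.WorldP), Rec F D w →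
  B16.EndStatementBPrinted D.C → DagBinding.EndpointExistence D.C.toB12 →
    T4ContinuumYM4Torus.ForSmallCouplings D fun g₀ => ∀ os : List (ULoop F), ∃ R : RateCarriers N, RRec F D g₀ os R

/-- N14 · NE1′ BY NAME at the carriers of record. -/
def S_N14 : Prop := ∀ (F : T4Family) (D : Datum F N) (g₀ : ℕ → ℝ) (os : List (ULoop F)) (R : RateCarriers N),
  RRec F D g₀ os R → N14At R.ne1

/-- N15 · NE2 BY NAME at the carriers of record. -/
def S_N15 : Prop := ∀ (F : T4Family) (D : Datum F N) (g₀ : ℕ → ℝ) (os : List (ULoop F)) (R : RateCarriers N),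
  RRec F D g₀ os R → N15At R.ne2

/-- N16 · NE3 BY NAME at the carriers of record. -/
def S_N16 : Prop := ∀ (F : T4Family) (D : Datum F N) (g₀ : ℕ → ℝ) (os : List (ULoop F)) (R : RateCarriers N),
  RRec F D g₀ os R → N16At R.ne3

/-- N17 · NE4 BY NAME on the datum at the dependent letters of record (stub form; glue form = `N17_of_U3edge`). -/
def S_N17 : Prop := ∀ (F : T4Family) (D : Datum F N) (g₀ : ℕ → ℝ) (os : List (ULoop F)) (R : RateCarriers N),
  RRec F D g₀ os R → N17At D R.u3

/-- N18 · NE5 BY NAME at the carriers of record. -/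
def S_N18 : Prop := ∀ (F : T4Family) (D : Datum F N) (g₀ : ℕ → ℝ) (os : List (ULoop F)) (R : RateCarriers N),
  RRec F D g₀ os R → N18At R.u3

/-- N22 · NE9 ∧ fading memory BY NAME at the carriers of record. -/
def S_N22 : Prop := ∀ (F : T4Family) (D : Datum F N) (g₀ : ℕ → ℝ) (os : List (ULoop F)) (R : RateCarriers N),
  RRec F D g₀ os R → N22At R.u3

/-- (D4) · the β-read-out binders at the carriers of record (the 7th stub IF N17 is filed as glue). -/
def S_D4 : Prop := ∀ (F : T4Family) (D : Datum F N) (g₀ : ℕ → ℝ) (os : List (ULoop F)) (R : RateCarriers N),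
  RRec F D g₀ os R → ReadOutAt D R.u3

/-! ### §7.4 K4's conclusion INSTANTIATED and the JOINS (kernel, for every `Rec`, `RRec`) -/

/-- **`RateInputs RRec`** — g74's PARAMETER 3 instantiated (∃-packaging, mirrors K5's `S_N27x`): some rate carriers of record for `(D, g₀, os)` carry the
six in-edges of N19.  K4 := `SpineRates Rec (RateInputs RRec)`; K5's edge reads `S_N19 SRec (RateInputs RRec)`. -/
def RateInputs : InputsPred N := fun F D g₀ os => ∃ R : RateCarriers N, RRec F D g₀ os R ∧ RatesAt D R

/-- ∀-PACKAGING twin: every rate carrier of record carries the six in-edges (no existence inside K4; existence then sits in K5's N27x as `∃ S R, …`). -/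
def RateInputsAll : InputsPred N := fun F D g₀ os => ∀ R : RateCarriers N, RRec F D g₀ os R → RatesAt D R

/-- **GLUE N17 (kernel)**: the dependent node from (D4), N18, N22 at the record — `n17At_of_u3` under the record predicate. -/
theorem N17_of_U3edge (hD4 : S_D4 RRec) (h18 : S_N18 RRec) (h22 : S_N22 RRec) : S_N17 RRec :=
  fun F D g₀ os R hR => n17At_of_u3 D (hD4 F D g₀ os R hR) (h18 F D g₀ os R hR) (h22 F D g₀ os R hR)

/-- **K4 JOIN, ∃-packaging, N17 a stub (kernel)**: existence of the carriers of record under the pins (R00x) with the six by-name estimates at them IS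
K4's conclusion hook — for all small-coupling tuned runs (`ForSmallCouplings.mono`). -/
theorem SpineRates_of (hx : S_R00x Rec RRec) (h14 : S_N14 RRec) (h15 : S_N15 RRec) (h16 : S_N16 RRec) (h17 : S_N17 RRec)
    (h18 : S_N18 RRec) (h22 : S_N22 RRec) : SpineRates Rec (RateInputs RRec) := by
  intro F D w hR hB hEnd
  refine (hx F D w hR hB hEnd).mono fun g₀ hg os => ?_
  obtain ⟨R, hRR⟩ := hg os
  exact ⟨R, hRR, h14 F D g₀ os R hRR, h15 F D g₀ os R hRR, h16 F D g₀ os R hRR, h17 F D g₀ os R hRR, h18 F D g₀ os R hRR,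
    h22 F D g₀ os R hRR⟩

/-- **K4 JOIN, ∃-packaging, N17 GLUE and (D4) a stub (kernel)** — seven binders: R00x, N14, N15, N16, N18, N22, D4. -/
theorem SpineRates_of_glueN17 (hx : S_R00x Rec RRec) (h14 : S_N14 RRec) (h15 : S_N15 RRec) (h16 : S_N16 RRec) (h18 : S_N18 RRec)
    (h22 : S_N22 RRec) (hD4 : S_D4 RRec) : SpineRates Rec (RateInputs RRec) :=
  SpineRates_of Rec RRec hx h14 h15 h16 (N17_of_U3edge RRec hD4 h18 h22) h18 h22

/-- **K4 JOIN, ∀-packaging (kernel)**: the six by-name estimates alone give the hook at `RateInputsAll` (thresholds trivial: `ForSmallCouplings.of_forall`). -/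
theorem SpineRates_of_forall (h14 : S_N14 RRec) (h15 : S_N15 RRec) (h16 : S_N16 RRec) (h17 : S_N17 RRec) (h18 : S_N18 RRec)
    (h22 : S_N22 RRec) : SpineRates Rec (RateInputsAll RRec) := by
  intro F D w _ _ _
  exact T4ContinuumYM4Torus.ForSmallCouplings.of_forall fun g₀ os R hRR =>
    ⟨h14 F D g₀ os R hRR, h15 F D g₀ os R hRR, h16 F D g₀ os R hRR, h17 F D g₀ os R hRR, h18 F D g₀ os R hRR, h22 F D g₀ os R hRR⟩

/-- Bookkeeping (kernel): under existence, the ∀-packaged hook gives the ∃-packaged one (`ForSmallCouplings.and` + `mono`). -/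
theorem spineRates_exists_of_forall (hx : S_R00x Rec RRec) (h : SpineRates Rec (RateInputsAll RRec)) : SpineRates Rec (RateInputs RRec) := by
  intro F D w hR hB hEnd
  exact ((hx F D w hR hB hEnd).and (h F D w hR hB hEnd)).mono fun g₀ hg os => by
    obtain ⟨R, hRR⟩ := hg.1 os
    exact ⟨R, hRR, hg.2 os R hRR⟩

/-- **`uvD59_of_K4K5stubs` — THE TOP JOIN AT STUB LEVEL FOR K4 AND K5 (kernel)**: K1 → K2 → K3 → the seven K4 stubs (∃-packaging, N17 a stub) → the
five K5 stubs with N19's edge reading `RateInputs RRec` → `UVD59 N`; every K4∕K5 stub is in the term (BC6), for EVERY `Rec`, `SRec`, `RRec`. -/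
theorem uvD59_of_K4K5stubs (h1 : KnitIR Rec) (h2 : FlowBounds Rec) (h3 : RenormalisationBeta Rec)
    (hx : S_R00x Rec RRec) (h14 : S_N14 RRec) (h15 : S_N15 RRec) (h16 : S_N16 RRec) (h17 : S_N17 RRec) (h18 : S_N18 RRec)
    (h22 : S_N22 RRec)
    (hx' : S_N27x Rec SRec) (h20 : S_N20 SRec) (h21 : S_N21 SRec) (h19 : S_N19 SRec (RateInputs RRec)) (hU4 : S_U4 SRec) :
    UVD59 N :=
  uvD59_of_clusters Rec (RateInputs RRec) h1 h2 h3 (SpineRates_of Rec RRec hx h14 h15 h16 h17 h18 h22)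
    (SpineMatching_of Rec SRec (RateInputs RRec) hx' h20 h21 h19 hU4)

/-- The same with N17 GLUED and (D4) a stub (kernel). -/
theorem uvD59_of_K4K5stubs_glueN17 (h1 : KnitIR Rec) (h2 : FlowBounds Rec) (h3 : RenormalisationBeta Rec)
    (hx : S_R00x Rec RRec) (h14 : S_N14 RRec) (h15 : S_N15 RRec) (h16 : S_N16 RRec) (h18 : S_N18 RRec) (h22 : S_N22 RRec)
    (hD4 : S_D4 RRec)
    (hx' : S_N27x Rec SRec) (h20 : S_N20 SRec) (h21 : S_N21 SRec) (h19 : S_N19 SRec (RateInputs RRec)) (hU4 : S_U4 SRec) :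
    UVD59 N :=
  uvD59_of_K4K5stubs Rec SRec RRec h1 h2 h3 hx h14 h15 h16 (N17_of_U3edge RRec hD4 h18 h22) h18 h22 hx' h20 h21 h19 hU4

/-- What N19's prover unpacks from the `Inputs` binder of `S_N19 SRec (RateInputs RRec)` (kernel, `Iff.rfl`). -/
theorem rateInputs_iff {F : T4Family} (D : Datum F N) (g₀ : ℕ → ℝ) (os : List (ULoop F)) :
    RateInputs RRec F D g₀ os ↔ ∃ R : RateCarriers N, RRec F D g₀ os R ∧ RatesAt D R := Iff.rfl

end SplitK4


end YMDAG.UVSplit
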